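import Literature.AlgebraicGeometry.Motives.AbelianVarietyCubeBilinear
import Literature.AlgebraicGeometry.Motives.AbelianVarietyCubeProofs
import Literature.AlgebraicGeometry.Motives.AbelianVarietyKummerBound
import HarnessLib

/-!
# The divisor `t_Q^* Θ - Θ` of the Weil pairing: pull-back by `[n]`, multiples, sums

For an abelian variety `A` over a field `K`, a Cartier divisor `Θ` on `A` and a rational point
`Q ∈ A(K)`, the divisor `D_Q = t_Q^* Θ - Θ` (`AbelianVariety.weilDiv Θ Q`) represents
`φ_Θ(Q) ∈ Pic⁰(A)` (Mumford, *Abelian Varieties*, §8; Milne 1986, §16: `ē_m^𝓛(a, a') = ē_m(a, φ_𝓛 a')`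
with `φ_𝓛(a') = t_{a'}^* 𝓛 ⊗ 𝓛⁻¹`). The Weil pairing `ē_N^Θ(P, Q) = e_N(P, D_Q)` is the Kummer
pairing of `D_Q` (Lang, *Abelian Varieties*, VII §2; `Motives/AbelianVarietyKummerPairing`), which
needs `[N]^* D_Q ∼ 0` for `Q ∈ A[N]`. This file proves the three class identities behind the
pairing, all from the **biadditivity of Mumford's pairing `Λ(Θ)`** (the cubical structure,
`cubicalStructure_linEquiv_holds`; `Motives/AbelianVarietyCubeBilinear`: the class of
`g^* t_P^* Θ - g^* Θ` along a `T`-point `g` is `Λ(P_T, g)`, biadditive in both variables):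

* `pullback_zsmul_weilDiv_linEquiv` — **`[n]^* (t_Q^* Θ - Θ) ∼ t_{Qⁿ}^* Θ - Θ`**
  (`Λ(Q_A, [n]) = Λ(Q_A, 𝟙ⁿ) = n Λ(Q_A, 𝟙) = Λ(Qⁿ_A, 𝟙)`); this is "`m_A⁻¹ D` is linearly
  equivalent to `mD`" for `D ∈ Pic⁰` of Milne §16 (p. 132, "see the paragraph following (9.2)") and
  Lang VII §2 ("`(nδ)⁻¹(X) ∼ nX ∼ 0`", Cor. of Thm. 2 of Ch. IV §1), in particular
  `pullback_zsmul_weilDiv_linEquiv_zero`: **`[N]^* D_Q ∼ 0` for `Q ∈ A[N]`**;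
* `nsmul_weilDiv_linEquiv` — **`n (t_Q^* Θ - Θ) ∼ t_{Qⁿ}^* Θ - Θ`** (`Λ(Qⁿ_A, 𝟙) = n Λ(Q_A, 𝟙)`);
* `weilDiv_mul_linEquiv` — **`t_{QQ'}^* Θ - Θ ∼ (t_Q^* Θ - Θ) + (t_{Q'}^* Θ - Θ)`**, the theorem
  of the square (Mumford §6, Cor. 4; `φ_Θ` is a homomorphism);

together with the commutation rule `t_x ≫ [n] = [n] ≫ t_{xⁿ}` (`translation_comp_zsmul_id`) and
its effect on rational functions (`translFF_functionFieldMap_zsmul'`, generalising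
`translFF_functionFieldMap_zsmul` of `Motives/AbelianVarietyKummerBound` from torsion `x`).

Everything is proved; no named facts (D-0026). Towards the named fact
`Literature.NumberTheory.DiophantineGeometry.weilPairing_rationalTateModule`.

## References

* [MumfordAV1970] D. Mumford, *Abelian Varieties* (1970), §6 Cor. 3–4 (pp. 59–61), §8
  (`φ_L`, `Λ(L)`, (iv) `n_X^* L ≅ Lⁿ` on `Pic⁰`).
* [Milne1986AbelianVarieties] J. S. Milne, *Abelian varieties*, in Cornell–Silverman (1986), §16,
  p. 132.
* [Lang1983AbelianVarieties] S. Lang, *Abelian Varieties*, Ch. VII §2 (PDF p. 138).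
* [GortzWedhorn2023] U. Görtz, T. Wedhorn, *Algebraic Geometry II* (2023), Prop. 27.167,
  Thm. 27.168.
-/

universe u v

open CategoryTheory CategoryTheory.Limits AlgebraicGeometry MonoidalCategory CartesianMonoidalCategory

noncomputable section

namespace Literature.AlgebraicGeometry.Motives

open scoped MonObj
open RatFn

/-! ### A class map is compatible with negatives -/

namespace CartierDivisor

variable {X : Scheme.{u}} [IsIntegral X] {Q : Type v} [AddCommGroup Q] {cl : CartierDivisor X → Q}
  (hadd : ∀ D E : CartierDivisor X, cl (D + E) = cl D + cl E)
  (heq : ∀ D E : CartierDivisor X, D.LinEquiv E ↔ cl D = cl E)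
include hadd heq

/-- An additive class map is compatible with negatives: `cl (-D) = -cl D`. [folklore] -/
theorem classMap_neg (D : CartierDivisor X) : cl (-D) = -cl D := by
  have h : cl (D + -D) = cl 0 := (heq _ _).1 (add_neg_sameDivisor D).linEquiv
  rw [hadd, classMap_zero hadd heq] at h
  exact eq_neg_of_add_eq_zero_right h

variable {X' : Scheme.{u}} [IsIntegral X'] (g : X' ⟶ X) [IsDominant g]

omit hadd heq in
/-- `g^*(-D)` and `-(g^* D)` are the same divisor. [folklore] -/
theorem pullback_neg_sameDivisor (D : CartierDivisor X) : ((-D).pullback g).SameDivisor (-(D.pullback g)) :=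
  fun i j x hi hj => by
    change IsUnitAt x (functionFieldMap g (D.f i)⁻¹ / (functionFieldMap g (D.f j))⁻¹)
    rw [map_inv₀, inv_div_inv, ← map_div₀]
    exact (D.isUnitAt_div j i (g x) hj hi).functionFieldMap

end CartierDivisor

namespace AbelianVariety

variable {K : Type u} [Field K] (A : AbelianVariety K)

/-! ### `[n]` and translations: `t_x ≫ [n] = [n] ≫ t_{xⁿ}` -/

/-- The underlying `K`-morphism of `[n]_A = n • 𝟙 A` (`n : ℕ`, written as an integer multiple) is
the `n`-th power of the identity point of `Hom_K(A, A)` (Görtz–Wedhorn II, (27.35.1)). [folklore] -/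
theorem hom_natCast_zsmul_id (n : ℕ) : (((n : ℕ) : ℤ) • 𝟙 A).hom.hom.hom = (𝟙 A.X) ^ n := by
  rw [natCast_zsmul, ← comp_nsmul_id (𝟙 A.X) n, Category.id_comp]

/-- **`t_x ≫ [n] = [n] ≫ t_{xⁿ}`**: multiplication by `n` is a homomorphism, so it intertwines the
translation by `x` with the translation by `xⁿ` (on `T`-points: `n (x q) = xⁿ (n q)`;
Görtz–Wedhorn II, Def. 27.1 and (27.35.1)). [folklore] -/
theorem translation_comp_zsmul_id (x : A.Points K) (n : ℕ) :
    A.translation x ≫ (((n : ℕ) : ℤ) • 𝟙 A).hom.hom.hom =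
      (((n : ℕ) : ℤ) • 𝟙 A).hom.hom.hom ≫ A.translation (x ^ n) := by
  unfold translation
  rw [MonObj.mul_comp, Category.id_comp, Category.assoc, natCast_zsmul, comp_nsmul_id,
    MonObj.comp_mul, Category.comp_id, comp_toSpecOver_comp]

/-- **`t_x^♯ ∘ [n]^♯ = [n]^♯ ∘ t_{xⁿ}^♯` on rational functions** (from `translation_comp_zsmul_id`;
for `xⁿ = 1` this is `translFF_functionFieldMap_zsmul` of `Motives/AbelianVarietyKummerBound`).
[folklore] -/
theorem translFF_functionFieldMap_zsmul' {n : ℕ}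
    [IsDominant (Hom.toSchemeHom (((n : ℕ) : ℤ) • 𝟙 A))] (x : A.Points K)
    (g : A.X.left.functionField) :
    A.translFF x (functionFieldMap (Hom.toSchemeHom (((n : ℕ) : ℤ) • 𝟙 A)) g) =
      functionFieldMap (Hom.toSchemeHom (((n : ℕ) : ℤ) • 𝟙 A)) (A.translFF (x ^ n) g) := by
  have hcomm : (A.translation x).left ≫ Hom.toSchemeHom (((n : ℕ) : ℤ) • 𝟙 A) =
      Hom.toSchemeHom (((n : ℕ) : ℤ) • 𝟙 A) ≫ (A.translation (x ^ n)).left :=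
    congrArg CommaMorphism.left (A.translation_comp_zsmul_id x n)
  haveI : IsDominant ((A.translation x).left ≫ Hom.toSchemeHom (((n : ℕ) : ℤ) • 𝟙 A)) :=
    inferInstance
  haveI : IsDominant (Hom.toSchemeHom (((n : ℕ) : ℤ) • 𝟙 A) ≫ (A.translation (x ^ n)).left) :=
    inferInstance
  have h1 := functionFieldMap_comp (Hom.toSchemeHom (((n : ℕ) : ℤ) • 𝟙 A)) (A.translation x).left
  have h2 := functionFieldMap_comp (A.translation (x ^ n)).left
    (Hom.toSchemeHom (((n : ℕ) : ℤ) • 𝟙 A))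
  have h3 : functionFieldMap ((A.translation x).left ≫ Hom.toSchemeHom (((n : ℕ) : ℤ) • 𝟙 A)) =
      functionFieldMap (Hom.toSchemeHom (((n : ℕ) : ℤ) • 𝟙 A) ≫ (A.translation (x ^ n)).left) :=
    functionFieldMap_congr hcomm
  rw [h1, h2] at h3
  exact congrArg (fun φ => φ g) h3

/-! ### The divisor `D_Q = t_Q^* Θ - Θ` -/

/-- **The divisor `D_Q = t_Q^* Θ - Θ`** of a Cartier divisor `Θ` and a rational point `Q ∈ A(K)`,
representing `φ_Θ(Q) = t_Q^* 𝒪(Θ) ⊗ 𝒪(Θ)⁻¹ ∈ Pic⁰(A)` (Mumford, *Abelian Varieties*, §8; Milne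
1986, §16, `φ_𝓛`); the second argument of the Weil pairing `ē_N^Θ(P, Q) = e_N(P, D_Q)`.
[cite: MumfordAV1970, §8 (definition of φ_L)] -/
def weilDiv (Θ : CartierDivisor A.X.left) (Q : A.Points K) : CartierDivisor A.X.left :=
  Θ.pullback (A.translation Q).left + -Θ

/-- `D_1 ∼ 0` (`t_1 = 𝟙`). [folklore] -/
theorem weilDiv_one_linEquiv_zero (Θ : CartierDivisor A.X.left) : (A.weilDiv Θ 1).LinEquiv 0 := by
  refine CartierDivisor.LinEquiv.add_neg (CartierDivisor.SameDivisor.linEquiv ?_)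
  haveI : IsDominant (𝟙 A.X.left) := inferInstance
  have e : (A.translation (1 : A.Points K)).left = 𝟙 A.X.left := by rw [translation_one]; rfl
  exact (Θ.pullback_congr_sameDivisor e).trans Θ.pullback_id_sameDivisor

section ClassComputations

variable {A} {Qc : Type v} [AddCommGroup Qc] {cl : CartierDivisor A.X.left → Qc}
  (hadd : ∀ D E : CartierDivisor A.X.left, cl (D + E) = cl D + cl E)
  (heq : ∀ D E : CartierDivisor A.X.left, D.LinEquiv E ↔ cl D = cl E)
include hadd heq

/-- The class of `D_Q` is `cl (t_Q^* Θ) - cl Θ`. [folklore] -/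
theorem classMap_weilDiv (Θ : CartierDivisor A.X.left) (Q : A.Points K) :
    cl (A.weilDiv Θ Q) = cl (Θ.pullback (A.translation Q).left) - cl Θ := by
  unfold weilDiv
  rw [hadd, CartierDivisor.classMap_neg hadd heq, sub_eq_add_neg]

/-- **`cl (t_P^* Θ) - cl Θ = Λ(P_A, 𝟙)`**: the class of `D_P` is Mumford's pairing of the constant
point `P_A = (A → Spec K →P A)` with the identity point (`cl_classPullback_translation_sub` of
`Motives/AbelianVarietyCubeBilinear` at `g = 𝟙`). [cite: MumfordAV1970, §8 (Λ(L) and φ_L)] -/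
theorem classMap_pullback_translation_sub (Θ : CartierDivisor A.X.left) (P : A.Points K) :
    cl (Θ.pullback (A.translation P).left) - cl Θ = Lam Θ cl (toSpecOver A.X ≫ P) (𝟙 A.X) := by
  rw [← cl_classPullback_translation_sub hadd heq (𝟙 A.X) P]
  have e : (𝟙 A.X : A.X ⟶ A.X).left = 𝟙 A.X.left := rfl
  rw [CartierDivisor.classPullback_congr e, CartierDivisor.classPullback_congr e]
  congr 1
  · exact (heq _ _).1 ((((Θ.classPullback (A.translation P).left).classPullback_id_linEquiv).trans
      (Θ.classPullback_linEquiv_pullback _)).symm)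
  · exact (heq _ _).1 (Θ.classPullback_id_linEquiv).symm

/-- **`cl ([n]^* t_P^* Θ) - cl ([n]^* Θ) = Λ(P_A, [n])`** with `[n] = 𝟙ⁿ` in `Hom_K(A, A)`
(`cl_classPullback_translation_sub` at `g = [n]`). [cite: MumfordAV1970, §8 (Λ(L) and φ_L)] -/
theorem classMap_pullback_zsmul_pullback_translation_sub (Θ : CartierDivisor A.X.left)
    (P : A.Points K) (n : ℕ) [IsDominant (Hom.toSchemeHom (((n : ℕ) : ℤ) • 𝟙 A))] :
    cl ((Θ.pullback (A.translation P).left).pullback (Hom.toSchemeHom (((n : ℕ) : ℤ) • 𝟙 A))) -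
        cl (Θ.pullback (Hom.toSchemeHom (((n : ℕ) : ℤ) • 𝟙 A))) =
      Lam Θ cl (toSpecOver A.X ≫ P) ((𝟙 A.X) ^ n) := by
  rw [← cl_classPullback_translation_sub hadd heq ((𝟙 A.X) ^ n) P]
  have e : ((𝟙 A.X : A.X ⟶ A.X) ^ n).left = Hom.toSchemeHom (((n : ℕ) : ℤ) • 𝟙 A) :=
    congrArg CommaMorphism.left (A.hom_natCast_zsmul_id n).symm
  rw [CartierDivisor.classPullback_congr e, CartierDivisor.classPullback_congr e]
  congr 1
  · refine (heq _ _).1 ?_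
    exact ((((Θ.classPullback (A.translation P).left).classPullback_linEquiv_pullback _)).trans
      ((Θ.classPullback_linEquiv_pullback _).pullback _)).symm
  · exact (heq _ _).1 (Θ.classPullback_linEquiv_pullback _).symm

/-- `Λ(P_A, 𝟙ⁿ) = Λ(Pⁿ_A, 𝟙)` — both are `n • Λ(P_A, 𝟙)` by the biadditivity of `Λ` (the cubical
structure `cubicalStructure_linEquiv_holds`). [folklore] -/
theorem Lam_toSpecOver_comp_pow (Θ : CartierDivisor A.X.left) (P : A.Points K) (n : ℕ) :
    Lam Θ cl (toSpecOver A.X ≫ P) ((𝟙 A.X) ^ n) = Lam Θ cl (toSpecOver A.X ≫ P ^ n) (𝟙 A.X) := by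
  rw [Lam_pow_right hadd heq A.cubicalStructure_linEquiv_holds, MonObj.comp_pow,
    Lam_pow_left hadd heq A.cubicalStructure_linEquiv_holds]

/-- In classes: `cl ([n]^* t_Q^* Θ) - cl ([n]^* Θ) = cl (t_{Qⁿ}^* Θ) - cl Θ`. [folklore] -/
theorem classMap_pullback_zsmul_pullback_translation_sub_eq (Θ : CartierDivisor A.X.left)
    (Q : A.Points K) (n : ℕ) [IsDominant (Hom.toSchemeHom (((n : ℕ) : ℤ) • 𝟙 A))] :
    cl ((Θ.pullback (A.translation Q).left).pullback (Hom.toSchemeHom (((n : ℕ) : ℤ) • 𝟙 A))) -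
        cl (Θ.pullback (Hom.toSchemeHom (((n : ℕ) : ℤ) • 𝟙 A))) =
      cl (Θ.pullback (A.translation (Q ^ n)).left) - cl Θ := by
  rw [classMap_pullback_zsmul_pullback_translation_sub hadd heq, Lam_toSpecOver_comp_pow hadd heq,
    classMap_pullback_translation_sub hadd heq]

/-- In classes: `n • cl D_Q = cl D_{Qⁿ}`. [folklore] -/
theorem nsmul_classMap_weilDiv (Θ : CartierDivisor A.X.left) (Q : A.Points K) (n : ℕ) :
    n • cl (A.weilDiv Θ Q) = cl (A.weilDiv Θ (Q ^ n)) := by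
  rw [classMap_weilDiv hadd heq, classMap_weilDiv hadd heq, classMap_pullback_translation_sub hadd heq,
    classMap_pullback_translation_sub hadd heq,
    ← Lam_pow_left hadd heq A.cubicalStructure_linEquiv_holds, ← MonObj.comp_pow]

/-- In classes: `cl D_{QQ'} = cl D_Q + cl D_{Q'}`. [folklore] -/
theorem classMap_weilDiv_mul (Θ : CartierDivisor A.X.left) (Q Q' : A.Points K) :
    cl (A.weilDiv Θ (Q * Q')) = cl (A.weilDiv Θ Q) + cl (A.weilDiv Θ Q') := by
  rw [classMap_weilDiv hadd heq, classMap_weilDiv hadd heq, classMap_weilDiv hadd heq,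
    classMap_pullback_translation_sub hadd heq, classMap_pullback_translation_sub hadd heq,
    classMap_pullback_translation_sub hadd heq, MonObj.comp_mul,
    Lam_mul_left hadd heq A.cubicalStructure_linEquiv_holds]

end ClassComputations

/-- **`[n]^* t_Q^* Θ + Θ ∼ t_{Qⁿ}^* Θ + [n]^* Θ`** — i.e. `[n]^*(t_Q^* Θ - Θ) ∼ t_{Qⁿ}^* Θ - Θ`,
the pull-back of `φ_Θ(Q) ∈ Pic⁰(A)` by `[n]` is its `n`-th multiple `φ_Θ(Qⁿ)` (Mumford, *Abelian
Varieties*, §8 (iv): "`n_X^* L ≅ Lⁿ` for `L ∈ Pic⁰(X)`"; Milne 1986, §16, p. 132: "`m_A⁻¹ D` is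
linearly equivalent to `mD`"). Proof: both differences are `n • Λ(Q_A, 𝟙)` by the biadditivity of
Mumford's pairing `Λ(Θ)` (the cubical structure). [cite: MumfordAV1970, §8 (iv)] -/
theorem pullback_zsmul_pullback_translation_add_linEquiv (Θ : CartierDivisor A.X.left)
    (Q : A.Points K) (n : ℕ) [IsDominant (Hom.toSchemeHom (((n : ℕ) : ℤ) • 𝟙 A))] :
    ((Θ.pullback (A.translation Q).left).pullback (Hom.toSchemeHom (((n : ℕ) : ℤ) • 𝟙 A)) + Θ).LinEquiv
      (Θ.pullback (A.translation (Q ^ n)).left + Θ.pullback (Hom.toSchemeHom (((n : ℕ) : ℤ) • 𝟙 A))) := by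
  obtain ⟨Qc, _, cl, hadd, heq⟩ := CartierDivisor.exists_classMap A.X.left
  have h := classMap_pullback_zsmul_pullback_translation_sub_eq hadd heq Θ Q n
  rw [sub_eq_sub_iff_add_eq_add] at h
  apply (heq _ _).2
  rw [hadd, hadd]
  exact h

/-- **`[n]^* D_Q ∼ D_{Qⁿ}`** (`D_Q = t_Q^* Θ - Θ`; Mumford §8 (iv), Milne §16 p. 132).
[cite: MumfordAV1970, §8 (iv)] -/
theorem pullback_zsmul_weilDiv_linEquiv (Θ : CartierDivisor A.X.left) (Q : A.Points K) (n : ℕ)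
    [IsDominant (Hom.toSchemeHom (((n : ℕ) : ℤ) • 𝟙 A))] :
    ((A.weilDiv Θ Q).pullback (Hom.toSchemeHom (((n : ℕ) : ℤ) • 𝟙 A))).LinEquiv
      (A.weilDiv Θ (Q ^ n)) := by
  obtain ⟨Qc, _, cl, hadd, heq⟩ := CartierDivisor.exists_classMap A.X.left
  have h := classMap_pullback_zsmul_pullback_translation_sub_eq hadd heq Θ Q n
  apply (heq _ _).2
  rw [classMap_weilDiv hadd heq, ← h]
  unfold weilDiv
  rw [(heq _ _).1 ((CartierDivisor.pullback_add_sameDivisor _ _ _).trans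
    ((CartierDivisor.SameDivisor.refl _).add (CartierDivisor.pullback_neg_sameDivisor _ Θ))).linEquiv,
    hadd, CartierDivisor.classMap_neg hadd heq, sub_eq_add_neg]

/-- **`[N]^* D_Q ∼ 0` for an `N`-torsion point `Q`** (`Q ^ N = 1`): the hypothesis under which the
Kummer pairing `e_N(·, D_Q)` is defined (Lang, *Abelian Varieties*, VII §2: "`(nδ)⁻¹(X) ∼ nX ∼ 0`";
Milne 1986, §16, p. 132). [cite: Lang1983AbelianVarieties, Ch. VII §2 (before Prop. 2)] -/
theorem pullback_zsmul_weilDiv_linEquiv_zero (Θ : CartierDivisor A.X.left) {N : ℕ}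
    [IsDominant (Hom.toSchemeHom (((N : ℕ) : ℤ) • 𝟙 A))] {Q : A.Points K} (hQ : Q ^ N = 1) :
    ((A.weilDiv Θ Q).pullback (Hom.toSchemeHom (((N : ℕ) : ℤ) • 𝟙 A))).LinEquiv 0 := by
  refine (A.pullback_zsmul_weilDiv_linEquiv Θ Q N).trans ?_
  rw [hQ]
  exact A.weilDiv_one_linEquiv_zero Θ

/-- **`n • D_Q ∼ D_{Qⁿ}`** — `φ_Θ(Qⁿ) = n φ_Θ(Q)`, the theorem of the square iterated (Mumford §6,
Cor. 4; Lang VII §2, Prop. 5: "`mnX = (φᵐ)`"). [cite: MumfordAV1970, §6 Cor. 4] -/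
theorem nsmul_weilDiv_linEquiv (Θ : CartierDivisor A.X.left) (Q : A.Points K) (n : ℕ) :
    (n • A.weilDiv Θ Q).LinEquiv (A.weilDiv Θ (Q ^ n)) := by
  obtain ⟨Qc, _, cl, hadd, heq⟩ := CartierDivisor.exists_classMap A.X.left
  apply (heq _ _).2
  rw [CartierDivisor.classMap_smul hadd heq, nsmul_classMap_weilDiv hadd heq]

/-- **`D_{QQ'} ∼ D_Q + D_{Q'}`** — `φ_Θ` is a homomorphism, i.e. the theorem of the square
`t_{QQ'}^* Θ + Θ ∼ t_Q^* Θ + t_{Q'}^* Θ` (Mumford §6, Cor. 4; Görtz–Wedhorn II, Thm. 27.168; Lang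
VII §2, the bilinearity of `e_n(a, ξ)` in `ξ`). [cite: MumfordAV1970, §6 Cor. 4] -/
theorem weilDiv_mul_linEquiv (Θ : CartierDivisor A.X.left) (Q Q' : A.Points K) :
    (A.weilDiv Θ (Q * Q')).LinEquiv (A.weilDiv Θ Q + A.weilDiv Θ Q') := by
  obtain ⟨Qc, _, cl, hadd, heq⟩ := CartierDivisor.exists_classMap A.X.left
  apply (heq _ _).2
  rw [hadd, classMap_weilDiv_mul hadd heq]

/-- `D_{Qⁿ} ∼ 0` if `Qⁿ = 1`; with `nsmul_weilDiv_linEquiv`: **`n • D_Q ∼ 0` for `Q ∈ A[n]`**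
(Lang VII §2: "`nX ∼ 0`"). [cite: Lang1983AbelianVarieties, Ch. VII §2 (before Prop. 2)] -/
theorem nsmul_weilDiv_linEquiv_zero (Θ : CartierDivisor A.X.left) {n : ℕ} {Q : A.Points K}
    (hQ : Q ^ n = 1) : (n • A.weilDiv Θ Q).LinEquiv 0 := by
  refine (A.nsmul_weilDiv_linEquiv Θ Q n).trans ?_
  rw [hQ]
  exact A.weilDiv_one_linEquiv_zero Θ

/-- **`t_P^* D_Q ∼ D_{QP} - D_P`**, precisely: `t_P^* D_Q + D_P ∼ D_{QP}` — since
`t_P^* t_Q^* Θ = t_{QP}^* Θ` on the nose (`t_P ≫ t_Q = t_{QP}`). [folklore] -/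
theorem pullback_translation_weilDiv_add_linEquiv (Θ : CartierDivisor A.X.left) (P Q : A.Points K) :
    ((A.weilDiv Θ Q).pullback (A.translation P).left + A.weilDiv Θ P).LinEquiv
      (A.weilDiv Θ (Q * P)) := by
  obtain ⟨Qc, _, cl, hadd, heq⟩ := CartierDivisor.exists_classMap A.X.left
  apply (heq _ _).2
  -- `t_P^* (t_Q^* Θ - Θ) = t_{QP}^* Θ - t_P^* Θ` as divisors
  have hcomp : (A.translation P).left ≫ (A.translation Q).left = (A.translation (Q * P)).left := by
    rw [← Over.comp_left, translation_comp]
  haveI : IsDominant ((A.translation P).left ≫ (A.translation Q).left) := inferInstance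
  have h1 : ((A.weilDiv Θ Q).pullback (A.translation P).left).LinEquiv
      (Θ.pullback (A.translation (Q * P)).left + -(Θ.pullback (A.translation P).left)) := by
    refine ((CartierDivisor.pullback_add_sameDivisor _ _ _).trans
      (CartierDivisor.SameDivisor.add ?_ (CartierDivisor.pullback_neg_sameDivisor _ Θ))).linEquiv
    exact (Θ.pullback_pullback_sameDivisor _ _).trans (Θ.pullback_congr_sameDivisor hcomp)
  rw [hadd, (heq _ _).1 h1, hadd, CartierDivisor.classMap_neg hadd heq, classMap_weilDiv hadd heq,
    classMap_weilDiv hadd heq]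
  abel

end AbelianVariety

end Literature.AlgebraicGeometry.Motives
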